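import Literature.Topology.FourManifolds.ImmersionOrientation
import Literature.Topology.FourManifolds.SmoothOrientationConnectedProofs
import Literature.Geometry.Manifold.OpenSubmanifoldMFDeriv
import HarnessLib

/-!
# The pointwise orientation character of a map from `ℝⁿ`: constancy on connected open sets,
# parity under precomposition, and maps extended from open submanifolds

Topic `Literature/Topology/FourManifolds`.  Elementary bookkeeping for orientation characters of
local diffeomorphisms `f : ℝⁿ ⊇ U → P` into an oriented `n`-manifold (M. W. Hirsch, *Differential
Topology* (1976), Ch. 4 §4, p. 101: induced orientations and the degree `±1` of a local
diffeomorphism between oriented manifolds; Ch. 4 §4, paragraph after Lemma 4.1: a connected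
orientable manifold has exactly two orientations), written POINTWISE and for TOTAL functions
`ℝⁿ → P` that are only assumed smooth on an open set — the form in which the orientation
characters of the two feet of a `0`-surgery are compared in `ZeroSphereSurgeryOrientation.lean`
(the orientability obstruction of Kosinski, *Differential Manifolds* (1993), VI (6.6)):

* `OrientPosAt o₀ o f x` — *`f` is orientation preserving at `x`* for the constant orientation
  `o₀` of `ℝⁿ` and the orientation `o` of `P`: `o (f x) = o₀ ↔ 0 < det df(x)` (so that
  `IsOrientationPreserving (modelSpace o₀) o f ↔ ∀ x, OrientPosAt o₀ o f x`, `Iff.rfl`);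
* `orientPosAt_iff_of_isPreconnected` — **constancy**: if `f` is `C^∞` with non-vanishing
  Jacobian on a preconnected open `U`, its character is the same at all points of `U` (pull `o`
  back along `f|U`, `SmoothOrientation.comapOfDetNeZero`, and compare with `o₀` on the connected
  open submanifold `U`, `SmoothOrientation.eq_or_eq_neg_of_connectedSpace_holds`);
* `orientPosAt_comp_iff` — **parity under precomposition** with a map `p : ℝⁿ → ℝⁿ`:
  `f ∘ p` preserves at `x` iff (`f` preserves at `p x` iff `0 < det dp(x)`) (chain rule);
* for a map `j : A → P` on an open submanifold `A ⊆ Z` extended by a constant to `Z` with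
  Mathlib's `Function.extend Subtype.val j (fun _ => p₀)`: `contMDiffAt_extend_val`,
  `mfderiv_extend_val` (the inclusion of an open submanifold has identity differential,
  `OpenSubmanifold.mfderiv_subtype_val`), `det_mfderiv_extend_val_ne_zero` /
  `injective_mfderiv_extend_val` for smooth embeddings `j`.

Everything here is proved; no named facts are introduced.

## References

* M. W. Hirsch, *Differential Topology*, GTM 33 (1976), Ch. 4 §4, p. 101 and the paragraph after
  Lemma 4.1. [HirschDT1976]
* A. A. Kosinski, *Differential Manifolds* (1993), VI (6.6). [Kosinski1993]
-/

open scoped Manifold ContDiff Topology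
open Set Function Filter Module

noncomputable section

namespace Literature.Topology.FourManifolds

/-- Local notation: `𝔼 n` is the model Euclidean space `EuclideanSpace ℝ (Fin n)`. -/
local notation "𝔼 " n:arg => EuclideanSpace ℝ (Fin n)

/-! ### The pointwise orientation character -/

section PosAt

variable {n : ℕ} {P : Type*} [TopologicalSpace P] [ChartedSpace (𝔼 n) P] [IsManifold (𝓡 n) ∞ P]

/-- **`f` is orientation preserving at `x`** for the constant orientation `o₀` of `ℝⁿ` and the
orientation `o` of the `n`-manifold `P`: the orientation of `P` at `f x` is `o₀` exactly when the
Jacobian determinant of `f` at `x` (in the preferred chart at `f x`) is positive — the pointwise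
form of the tree's `IsOrientationPreserving (SmoothOrientation.modelSpace o₀) o f` (Hirsch 1976,
Ch. 4 §4, p. 101).  For a map with singular differential at `x` the predicate reads
`o (f x) ≠ o₀`; it is only used at points where `det df(x) ≠ 0`. [cite: HirschDT1976, Ch. 4 §4, p. 101] -/
def OrientPosAt (o₀ : Orientation ℝ (𝔼 n) (Fin (finrank ℝ (𝔼 n)))) (o : SmoothOrientation (𝓡 n) P)
    (f : 𝔼 n → P) (x : 𝔼 n) : Prop :=
  o (f x) = o₀ ↔ 0 < LinearMap.det (M := 𝔼 n) (mfderiv 𝓘(ℝ, 𝔼 n) (𝓡 n) f x).toLinearMap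

variable {o₀ : Orientation ℝ (𝔼 n) (Fin (finrank ℝ (𝔼 n)))} {o : SmoothOrientation (𝓡 n) P}

/-- `f` preserves the orientations `(o₀, o)` in the sense of the tree iff it is orientation
preserving at every point. [folklore] -/
theorem isOrientationPreserving_iff_forall_orientPosAt {f : 𝔼 n → P} :
    IsOrientationPreserving (SmoothOrientation.modelSpace o₀) o f ↔ ∀ x, OrientPosAt o₀ o f x :=
  Iff.rfl

/-- The orientation character at `x` only depends on the germ of the map at `x`. [folklore] -/
theorem orientPosAt_congr_of_eventuallyEq {f g : 𝔼 n → P} {x : 𝔼 n}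
    (h : f =ᶠ[𝓝 x] g) : OrientPosAt o₀ o f x ↔ OrientPosAt o₀ o g x := by
  unfold OrientPosAt
  rw [h.mfderiv_eq, h.eq_of_nhds]

omit [IsManifold (𝓡 n) ∞ P] in
/-- **Chain rule for the Jacobian determinant** of `f ∘ p`, `p : ℝⁿ → ℝⁿ`. [folklore] -/
theorem det_mfderiv_comp_eq {f : 𝔼 n → P} {p : 𝔼 n → 𝔼 n} {x : 𝔼 n}
    (hp : DifferentiableAt ℝ p x) (hf : MDifferentiableAt 𝓘(ℝ, 𝔼 n) (𝓡 n) f (p x)) :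
    LinearMap.det (M := 𝔼 n) (mfderiv 𝓘(ℝ, 𝔼 n) (𝓡 n) (f ∘ p) x).toLinearMap =
      LinearMap.det (M := 𝔼 n) (mfderiv 𝓘(ℝ, 𝔼 n) (𝓡 n) f (p x)).toLinearMap *
        LinearMap.det ((fderiv ℝ p x : (𝔼 n) →L[ℝ] 𝔼 n) : (𝔼 n) →ₗ[ℝ] 𝔼 n) := by
  rw [mfderiv_comp x hf hp.mdifferentiableAt, ← mfderiv_eq_fderiv]
  exact LinearMap.det_comp (M := 𝔼 n) (mfderiv 𝓘(ℝ, 𝔼 n) (𝓡 n) f (p x)).toLinearMap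
    (mfderiv 𝓘(ℝ, 𝔼 n) 𝓘(ℝ, 𝔼 n) p x).toLinearMap

/-- **Parity of the orientation character under precomposition** (Hirsch 1976, Ch. 4 §4, p. 101:
degrees multiply).  If `p : ℝⁿ → ℝⁿ` is differentiable at `x` and `f` at `p x`, both with
invertible differential, then `f ∘ p` is orientation preserving at `x` iff: `f` is orientation
preserving at `p x` exactly when `det dp(x) > 0`. [cite: HirschDT1976, Ch. 4 §4, p. 101] -/
theorem orientPosAt_comp_iff {f : 𝔼 n → P} {p : 𝔼 n → 𝔼 n} {x : 𝔼 n}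
    (hp : DifferentiableAt ℝ p x) (hf : MDifferentiableAt 𝓘(ℝ, 𝔼 n) (𝓡 n) f (p x))
    (hdf : LinearMap.det (M := 𝔼 n) (mfderiv 𝓘(ℝ, 𝔼 n) (𝓡 n) f (p x)).toLinearMap ≠ 0)
    (hdp : LinearMap.det ((fderiv ℝ p x : (𝔼 n) →L[ℝ] 𝔼 n) : (𝔼 n) →ₗ[ℝ] 𝔼 n) ≠ 0) :
    OrientPosAt o₀ o (f ∘ p) x ↔
      (OrientPosAt o₀ o f (p x) ↔
        0 < LinearMap.det ((fderiv ℝ p x : (𝔼 n) →L[ℝ] 𝔼 n) : (𝔼 n) →ₗ[ℝ] 𝔼 n)) := by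
  unfold OrientPosAt
  rw [Function.comp_apply, det_mfderiv_comp_eq hp hf]
  set a := LinearMap.det (M := 𝔼 n) (mfderiv 𝓘(ℝ, 𝔼 n) (𝓡 n) f (p x)).toLinearMap with ha
  set b := LinearMap.det ((fderiv ℝ p x : (𝔼 n) →L[ℝ] 𝔼 n) : (𝔼 n) →ₗ[ℝ] 𝔼 n) with hb
  by_cases h : 0 < b
  · rw [mul_pos_iff_of_pos_right h]
    tauto
  · have hb' : b < 0 := lt_of_le_of_ne (not_lt.1 h) hdp
    have hab : 0 < a * b ↔ ¬ 0 < a := by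
      constructor
      · intro hab ha'
        nlinarith
      · intro ha'
        have : a < 0 := lt_of_le_of_ne (not_lt.1 ha') hdf
        nlinarith
    rw [hab]
    tauto

omit [IsManifold (𝓡 n) ∞ P] in
/-- Jacobians of the two factors of a composite with invertible Jacobian are invertible. [folklore] -/
theorem det_ne_zero_of_det_mfderiv_comp_ne_zero {f : 𝔼 n → P}
    {p : 𝔼 n → 𝔼 n} {x : 𝔼 n} (hp : DifferentiableAt ℝ p x)
    (hf : MDifferentiableAt 𝓘(ℝ, 𝔼 n) (𝓡 n) f (p x))
    (h : LinearMap.det (M := 𝔼 n) (mfderiv 𝓘(ℝ, 𝔼 n) (𝓡 n) (f ∘ p) x).toLinearMap ≠ 0) :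
    LinearMap.det (M := 𝔼 n) (mfderiv 𝓘(ℝ, 𝔼 n) (𝓡 n) f (p x)).toLinearMap ≠ 0 ∧
      LinearMap.det ((fderiv ℝ p x : (𝔼 n) →L[ℝ] 𝔼 n) : (𝔼 n) →ₗ[ℝ] 𝔼 n) ≠ 0 := by
  rw [det_mfderiv_comp_eq hp hf] at h
  exact ⟨left_ne_zero_of_mul h, right_ne_zero_of_mul h⟩

/-- Bookkeeping: "`a = b` iff `0 < d`" is the statement that the sign-twisted orientation
`if 0 < d then a else -a` equals `b` (two orientations of `ℝⁿ` are equal or opposite). [folklore] -/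
theorem orientation_eq_iff_pos_iff_ite_eq {a b : Orientation ℝ (𝔼 n) (Fin (finrank ℝ (𝔼 n)))}
    {d : ℝ} : (a = b ↔ 0 < d) ↔ (if 0 < d then a else -a) = b := by
  have hcard : Fintype.card (Fin (finrank ℝ (𝔼 n))) = finrank ℝ (𝔼 n) := Fintype.card_fin _
  by_cases h : 0 < d
  · rw [if_pos h]
    simp only [h, iff_true]
  · rw [if_neg h]
    simp only [h, iff_false]
    change a ≠ b ↔ -a = b
    rw [Orientation.ne_iff_eq_neg _ _ hcard]
    constructor
    · intro e; rw [e]; exact _root_.neg_neg b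
    · intro e; rw [← e]; exact (_root_.neg_neg a).symm

/-- **Constancy of the orientation character on a connected open set** (Hirsch 1976, Ch. 4 §4:
a connected orientable manifold has exactly two orientations).  If `f : ℝⁿ → P` is `C^∞` with
non-vanishing Jacobian determinant on the preconnected open set `U`, then `f` is orientation
preserving at one point of `U` iff at every point of `U`: the pull-back of `o` along `f|U`
(`SmoothOrientation.comapOfDetNeZero`) is `± o₀` on the connected open submanifold `U`
(`SmoothOrientation.eq_or_eq_neg_of_connectedSpace_holds`).
[cite: HirschDT1976, Ch. 4 §4, p. 101 and para. after Lemma 4.1] -/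
theorem orientPosAt_iff_of_isPreconnected {f : 𝔼 n → P} {U : Set (𝔼 n)} (hUo : IsOpen U)
    (hUc : IsPreconnected U) (hf : ContMDiffOn 𝓘(ℝ, 𝔼 n) (𝓡 n) ∞ f U)
    (hd : ∀ x ∈ U, LinearMap.det (M := 𝔼 n) (mfderiv 𝓘(ℝ, 𝔼 n) (𝓡 n) f x).toLinearMap ≠ 0)
    {x y : 𝔼 n} (hx : x ∈ U) (hy : y ∈ U) : OrientPosAt o₀ o f x ↔ OrientPosAt o₀ o f y := by
  let U' : TopologicalSpace.Opens (𝔼 n) := ⟨U, hUo⟩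
  haveI : PreconnectedSpace U' := Subtype.preconnectedSpace hUc
  haveI : ConnectedSpace U' := ⟨⟨⟨x, hx⟩⟩⟩
  set F : U' → P := fun z => f z with hF
  have hfat : ∀ z : U', ContMDiffAt 𝓘(ℝ, 𝔼 n) (𝓡 n) ∞ f (z : 𝔼 n) := fun z =>
    hf.contMDiffAt (hUo.mem_nhds z.2)
  have hFs : ContMDiff 𝓘(ℝ, 𝔼 n) (𝓡 n) ∞ F := fun z => contMDiffAt_subtype_iff.2 (hfat z)
  have hdF : ∀ z : U', mfderiv 𝓘(ℝ, 𝔼 n) (𝓡 n) F z = mfderiv 𝓘(ℝ, 𝔼 n) (𝓡 n) f (z : 𝔼 n) :=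
    fun z => by
    have h1 : F = f ∘ (Subtype.val : U' → 𝔼 n) := rfl
    rw [h1, mfderiv_comp z ((hfat z).mdifferentiableAt (by simp))
      (Literature.Geometry.Manifold.OpenSubmanifold.mdifferentiableAt_subtype_val z),
      Literature.Geometry.Manifold.OpenSubmanifold.mfderiv_subtype_val]
    exact ContinuousLinearMap.comp_id _
  have hd0 : ∀ z : U', LinearMap.det (M := 𝔼 n) (mfderiv 𝓘(ℝ, 𝔼 n) (𝓡 n) F z).toLinearMap ≠ 0 :=
    fun z => by rw [hdF]; exact hd z z.2
  set oF : SmoothOrientation 𝓘(ℝ, 𝔼 n) U' := o.comapOfDetNeZero F hFs (by simp) hd0 with hoF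
  set oU : SmoothOrientation 𝓘(ℝ, 𝔼 n) U' := (SmoothOrientation.modelSpace o₀).restrict U' with hoU
  -- at each point, `f` preserves iff the pull-back agrees with `o₀`
  have key : ∀ z : U', OrientPosAt o₀ o f z ↔ oF z = oU z := fun z => by
    rw [hoF, SmoothOrientation.comapOfDetNeZero_apply, hdF, hoU, SmoothOrientation.restrict_apply,
      SmoothOrientation.modelSpace_apply]
    exact orientation_eq_iff_pos_iff_ite_eq
  rcases SmoothOrientation.eq_or_eq_neg_of_connectedSpace_holds oU oF with h | h
  · exact iff_of_true ((key ⟨x, hx⟩).2 (by rw [h])) ((key ⟨y, hy⟩).2 (by rw [h]))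
  · have hne : ∀ z : U', oF z ≠ oU z := fun z e => by
      rw [h, SmoothOrientation.neg_apply] at e
      exact Module.Ray.ne_neg_self (oU z) e.symm
    exact iff_of_false (fun h' => hne _ ((key ⟨x, hx⟩).1 h')) (fun h' => hne _ ((key ⟨y, hy⟩).1 h'))

end PosAt

/-! ### Maps extended by a constant from an open submanifold

A map `j : A → P` on an open submanifold `A ⊆ Z` is extended by a constant to `Z` with Mathlib's
`Function.extend Subtype.val j (fun _ => p₀)` (on `A` it is `j`, `Subtype.val_injective.extend_apply`);
only its germ along `A` is ever used. -/

section ExtendDef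

variable {Z : Type*} {P : Type*} {q : Z → Prop} (j : Subtype q → P) (p₀ : P)

/-- On `A = {z | q z}` the extension by a constant is `j`. [folklore] -/
theorem extend_val_apply_of_mem {z : Z} (h : q z) :
    Function.extend Subtype.val j (fun _ => p₀) z = j ⟨z, h⟩ :=
  Subtype.val_injective.extend_apply j (fun _ => p₀) ⟨z, h⟩

/-- On points of `A` the extension by a constant is `j`. [folklore] -/
@[simp] theorem extend_val_coe (a : Subtype q) : Function.extend Subtype.val j (fun _ => p₀) a = j a :=
  Subtype.val_injective.extend_apply j (fun _ => p₀) a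

/-- The extension by a constant restricted to `A` is `j`. [folklore] -/
theorem extend_val_comp_val : Function.extend Subtype.val j (fun _ => p₀) ∘ Subtype.val = j :=
  funext fun a => extend_val_coe j p₀ a

end ExtendDef

section Extend

variable {EZ HZ : Type*} [NormedAddCommGroup EZ] [NormedSpace ℝ EZ] [TopologicalSpace HZ]
  {IZ : ModelWithCorners ℝ EZ HZ} {Z : Type*} [TopologicalSpace Z] [ChartedSpace HZ Z]
  {EP HP : Type*} [NormedAddCommGroup EP] [NormedSpace ℝ EP] [TopologicalSpace HP]
  {IP : ModelWithCorners ℝ EP HP} {P : Type*} [TopologicalSpace P] [ChartedSpace HP P]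
  {A : TopologicalSpace.Opens Z} {j : A → P} (p₀ : P)

/-- **The extension by a constant of a `C^∞` map on an open submanifold is `C^∞` at the points of
the submanifold** (`contMDiffAt_subtype_iff`). [folklore] -/
theorem contMDiffAt_extend_val (hj : ContMDiff IZ IP ∞ j) {z : Z} (h : z ∈ A) :
    ContMDiffAt IZ IP ∞ (Function.extend Subtype.val j (fun _ => p₀)) z := by
  have h1 : ContMDiffAt IZ IP ∞ (fun x : A => Function.extend Subtype.val j (fun _ => p₀) x) ⟨z, h⟩ := by
    rw [show (fun x : A => Function.extend Subtype.val j (fun _ => p₀) x) = j from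
      extend_val_comp_val j p₀]
    exact hj _
  exact contMDiffAt_subtype_iff.1 h1

/-- **The differential of the extension at a point of `A` is the differential of `j`** (the
inclusion of the open submanifold `A` has identity differential,
`OpenSubmanifold.mfderiv_subtype_val`). [folklore] -/
theorem mfderiv_extend_val [IsManifold IP 1 P] (hj : ContMDiff IZ IP ∞ j) (a : A) :
    mfderiv IZ IP (Function.extend Subtype.val j (fun _ => p₀)) (a : Z) = mfderiv IZ IP j a := by
  have h := mfderiv_comp a ((contMDiffAt_extend_val p₀ hj a.2).mdifferentiableAt (by simp))
    (Literature.Geometry.Manifold.OpenSubmanifold.mdifferentiableAt_subtype_val (I := IZ) a)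
  rw [extend_val_comp_val j p₀, Literature.Geometry.Manifold.OpenSubmanifold.mfderiv_subtype_val] at h
  rw [h]
  exact (ContinuousLinearMap.comp_id _).symm

/-- The differential of the extension of a `C^∞` immersion is injective at the points of `A`.
[folklore] -/
theorem injective_mfderiv_extend_val [IsManifold IP 1 P] (hj : Manifold.IsSmoothEmbedding IZ IP ∞ j)
    (a : A) : Injective (mfderiv IZ IP (Function.extend Subtype.val j (fun _ => p₀)) (a : Z)) := by
  rw [mfderiv_extend_val p₀ hj.contMDiff a]
  exact injective_mfderiv_of_isImmersionAt' (hj.isImmersion.isImmersionAt a)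

end Extend

section ExtendDet

variable {E HZ HP : Type*} [NormedAddCommGroup E] [NormedSpace ℝ E] [FiniteDimensional ℝ E]
  [TopologicalSpace HZ] [TopologicalSpace HP] {IZ : ModelWithCorners ℝ E HZ} {IP : ModelWithCorners ℝ E HP}
  {Z : Type*} [TopologicalSpace Z] [ChartedSpace HZ Z]
  {P : Type*} [TopologicalSpace P] [ChartedSpace HP P] [IsManifold IP 1 P]
  {A : TopologicalSpace.Opens Z} {j : A → P} (p₀ : P)

/-- **The Jacobian determinant of the extension of a codimension-`0` smooth embedding does not
vanish at the points of `A`** (`det_mfderiv_ne_zero_of_isImmersionAt`). [folklore] -/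
theorem det_mfderiv_extend_val_ne_zero (hj : Manifold.IsSmoothEmbedding IZ IP ∞ j) (a : A) :
    LinearMap.det (M := E)
      (mfderiv IZ IP (Function.extend Subtype.val j (fun _ => p₀)) (a : Z)).toLinearMap ≠ 0 := by
  rw [mfderiv_extend_val p₀ hj.contMDiff a]
  exact det_mfderiv_ne_zero_of_isImmersionAt (hj.isImmersion.isImmersionAt a)

end ExtendDet

end Literature.Topology.FourManifolds

end
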